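import Summits.FinalStateConjecture.FinalStateConjecture.Theorems.SwallowTheDatumKerrShieldedSettlesStubCollarCauchy
import Summits.FinalStateConjecture.FinalStateConjecture.Theorems.SwallowTheDatumKerrShieldedSettlesStubCollarEmbedsMGHDAux
import Literature.Geometry.Lorentzian.OpensChartGeodesicODE
import Literature.Geometry.Lorentzian.KerrSchildDivergence
import Literature.Geometry.Lorentzian.OpensCausality
import HarnessLib

/-!
# `KerrShieldedSettles`, line `tapered-temporal-collar` — stub S5 `stub_scriTransport`, part 1:
# chart engines (geodesics of two charts with the same components; the `u`-clock along causal
# curves; pushing `J⁺` through a map that is only good on an open set)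

Support file for crux `stmt-FinalStateConjecture-10054`
(`Summit.FinalStateConjecture.FinalStateConjecture.Theses.SwallowTheDatum.KerrShieldedSettles`), stub S5
`stub_scriTransport` (transport of the Kerr-side sojourn estimate through the chart map `χ` into a vacuum
Cauchy development).  Three engines, all elementary:

* `ScriTransport.isGeodesicOn_transfer` — **two metrics on two open subsets of the same normed space with
  the same components `G` have the same geodesics** where the curves agree (O'Neill 1983, Ch. 3,
  Cor. 3.21: both are the solutions of `c'' + Γ_G(c', c') = 0`; the Christoffel map depends only on `G`,
  `christoffel_congr`);
* `ScriTransport.strictMonoOn_u` — **the clock `u = t* − T(r)` runs forward along every future CAUSAL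
  curve of the ingoing Kerr–Schild chart** (the sibling file `…StubCollarCauchy` proves it for timelike
  curves; the pointwise clock `CollarCauchy.clock_pos` is already stated for causal vectors), whence causal
  curves issuing from the bent leaf `{u = 0}` stay in the tapered collar `W = {0 < u + (r − r₁)/4}`
  (`curve_mem_collar`);
* `ScriTransport.image_causalFuture_subset` — **`f(J⁺(S)) ⊆ J⁺(f S)` for a map `f` which is differentiable
  with future-causal-preserving differential only on a set `O`**, provided every future causal curve from
  `S` stays in `O` (O'Neill 1983, Ch. 14, pp. 402–403, localised).

References: B. O'Neill, *Semi-Riemannian geometry* (1983), Ch. 3, Cor. 3.21; Ch. 5, p. 145; Ch. 14,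
pp. 402–403; M. Dafermos, I. Rodnianski, arXiv:0811.0354, §5.1.
-/

set_option linter.dupNamespace false

noncomputable section

open Set Filter Function
open scoped Manifold ContDiff Topology
open Literature.Geometry.Lorentzian
open Summit.FinalStateConjecture.FinalStateConjecture.Theorems.KerrShieldedDataExist.Negative
  (bentHeight bentSlope hasDerivAt_bentHeight bentSlope_nonneg mass_pos)

namespace Summit.FinalStateConjecture.FinalStateConjecture.Theorems.SwallowTheDatum.KerrShieldedSettles

namespace ScriTransport

/-! ## Geodesics of two charts with the same metric components -/

section Charts

variable {E : Type*} [NormedAddCommGroup E] [NormedSpace ℝ E] [FiniteDimensional ℝ E]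
  {U₁ U₂ : TopologicalSpace.Opens E} {n : ℕ∞ω}
  {g₁ : PseudoRiemannianMetric 𝓘(ℝ, E) n E (TangentSpace 𝓘(ℝ, E) : U₁ → Type _)}
  {g₂ : PseudoRiemannianMetric 𝓘(ℝ, E) n E (TangentSpace 𝓘(ℝ, E) : U₂ → Type _)}
  {G : E → E →L[ℝ] E →L[ℝ] ℝ}

/-- **The Christoffel map of a chart metric depends only on its components**: two metrics on open
subsets `U₁, U₂ ⊆ E` with the same components `G` have the same Christoffel map at a common point
(`2 G_x(Γ(X, Y), Z) = K_G(X, Y, Z)` determines `Γ` by nondegeneracy). O'Neill 1983, Ch. 3, Prop. 3.13.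
[cite: ONeill1983, Ch. 3, Prop. 3.13] -/
theorem christoffel_congr (h₁ : ∀ y, g₁.val y = G y) (h₂ : ∀ y, g₂.val y = G y)
    {x₁ : U₁} {x₂ : U₂} (hx : (x₁ : E) = x₂) (Y X : E) :
    (OpensChart.christoffel g₁ G x₁ Y X : E) = OpensChart.christoffel g₂ G x₂ Y X := by
  have k₁ : ∀ Z, 2 * g₁.val x₁ (OpensChart.christoffel g₁ G x₁ Y X) Z = OpensChart.koszulForm G x₁ Y X Z :=
    fun Z ↦ OpensChart.two_mul_val_christoffel (g := g₁) (G := G) x₁ Y X Z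
  have k₂ : ∀ Z, 2 * g₂.val x₂ (OpensChart.christoffel g₂ G x₂ Y X) Z = OpensChart.koszulForm G x₂ Y X Z :=
    fun Z ↦ OpensChart.two_mul_val_christoffel (g := g₂) (G := G) x₂ Y X Z
  have hsub : (OpensChart.christoffel g₁ G x₁ Y X : E) - OpensChart.christoffel g₂ G x₂ Y X = 0 := by
    refine g₁.nondegenerate x₁ _ fun Z ↦ ?_
    have e₁ := k₁ Z
    have e₂ := k₂ Z
    rw [h₂] at e₂
    rw [h₁, hx] at e₁ ⊢
    change (G x₂) ((OpensChart.christoffel g₁ G x₁ Y X : E) - OpensChart.christoffel g₂ G x₂ Y X) Z = 0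
    rw [map_sub, _root_.sub_apply]
    change 2 * G x₂ (OpensChart.christoffel g₁ G x₁ Y X) Z = _ at e₁
    change 2 * G x₂ (OpensChart.christoffel g₂ G x₂ Y X) Z = _ at e₂
    linarith
  exact sub_eq_zero.1 hsub

/-- **Transfer of geodesics between two charts with the same components.** Let `g₁` on `U₁` and `g₂`
on `U₂` (open subsets of `E`) have the same differentiable components `G`, and let `γ₁ : ℝ → U₁` be a
geodesic of `g₁` on the open parameter set `s`. If `γ₂ : ℝ → U₂` has the same coordinate expression as
`γ₁` on `s`, then `γ₂` is a geodesic of `g₂` on `s`, with the same velocity (both solve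
`c'' + Γ_G(c', c') = 0`, O'Neill 1983, Ch. 3, Cor. 3.21, in the two directions
`OpensChart.hasDerivAt_of_isGeodesicOn` / `OpensChart.isGeodesicOn_of_hasDerivAt`).
[cite: ONeill1983, Ch. 3, Cor. 3.21] -/
theorem isGeodesicOn_transfer [g₁.HasLeviCivita] [g₂.HasLeviCivita]
    (h₁ : ∀ y, g₁.val y = G y) (h₂ : ∀ y, g₂.val y = G y)
    (hGd₁ : ∀ y : U₁, DifferentiableAt ℝ G y) (hGd₂ : ∀ y : U₂, DifferentiableAt ℝ G y)
    {γ₁ : ℝ → U₁} {γ₂ : ℝ → U₂} {s : Set ℝ} (hs : IsOpen s)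
    (hγ₁ : IsGeodesicOn g₁.leviCivita γ₁ s) (heq : ∀ t ∈ s, (γ₂ t : E) = γ₁ t) :
    IsGeodesicOn g₂.leviCivita γ₂ s ∧
      ∀ t ∈ s, (velocity 𝓘(ℝ, E) γ₂ t : E) = velocity 𝓘(ℝ, E) γ₁ t := by
  have H := fun t (ht : t ∈ s) ↦ OpensChart.hasDerivAt_of_isGeodesicOn h₁ hGd₁ hγ₁ ht
  refine OpensChart.isGeodesicOn_of_hasDerivAt h₂ hGd₂ hs (c := fun t ↦ (γ₂ t : E))
    (c' := fun t ↦ (velocity 𝓘(ℝ, E) γ₁ t : E))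
    (c'' := fun t ↦ -(OpensChart.christoffel g₁ G (γ₁ t) (velocity 𝓘(ℝ, E) γ₁ t)
      (velocity 𝓘(ℝ, E) γ₁ t) : E))
    (fun _ ↦ rfl) (fun t ht ↦ ?_) (fun t ht ↦ (H t ht).2) (fun t ht ↦ ?_)
  · have hev : (fun t' ↦ (γ₁ t' : E)) =ᶠ[𝓝 t] fun t' ↦ (γ₂ t' : E) := by
      filter_upwards [hs.mem_nhds ht] with t' ht' using (heq t' ht').symm
    exact (H t ht).1.congr_of_eventuallyEq hev.symm
  · rw [christoffel_congr h₁ h₂ (heq t ht).symm]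
    exact neg_add_cancel _

end Charts

/-! ## The `u`-clock along future causal curves of the Kerr chart -/

section Clock

variable [Kerr.Facts] {M a r₁ : ℝ} {hM : 0 ≤ M} {γ : ℝ → Kerr.region a r₁} {s : Set ℝ}

/-- Along a future causal curve of the Kerr chart the coordinate curve is differentiable with velocity
`v = deriv (γ : E4)`, `g(v, v) ≤ 0`, `v ≠ 0` and `g(V, v) < 0` (`V = Kerr.timeVector`). O'Neill 1983,
Ch. 14, p. 402. [cite: ONeill1983, Ch. 14, p. 402] -/
theorem causalCurve_velocity (hγ : (Kerr.smoothMetric M a r₁).IsFutureCausalCurveOn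
      ((Kerr.timeOrientation M a r₁ hM).ofLE le_top) γ s) {t : ℝ} (ht : t ∈ s) :
    HasDerivAt (fun σ ↦ (γ σ : E4)) (deriv (fun σ ↦ (γ σ : E4)) t) t ∧
      Kerr.bilin M a (γ t) (deriv (fun σ ↦ (γ σ : E4)) t) (deriv (fun σ ↦ (γ σ : E4)) t) ≤ 0 ∧
      deriv (fun σ ↦ (γ σ : E4)) t ≠ 0 ∧
      Kerr.bilin M a (γ t) (Kerr.timeVector M a (γ t)) (deriv (fun σ ↦ (γ σ : E4)) t) < 0 := by
  obtain ⟨hd, ⟨hc, hne⟩, hfd⟩ := hγ t ht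
  have hd' : DifferentiableAt ℝ (fun σ ↦ (γ σ : E4)) t :=
    mdifferentiableAt_iff_differentiableAt.mp
      ((mdifferentiableAt_subtypeVal_comp_curve_iff (I := 𝓘(ℝ, E4)) (Kerr.region a r₁)).2 hd)
  have hv := CollarCauchy.velocity_eq_deriv γ t
  refine ⟨hd'.hasDerivAt, ?_, ?_, ?_⟩
  · have h1 : Kerr.bilin M a (γ t) (velocity 𝓘(ℝ, E4) γ t) (velocity 𝓘(ℝ, E4) γ t) ≤ 0 := hc
    rwa [hv] at h1
  · intro h0
    exact hne (hv.trans h0)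
  · have h2 : Kerr.bilin M a (γ t) (Kerr.timeVector M a (γ t)) (velocity 𝓘(ℝ, E4) γ t) < 0 := hfd
    rwa [hv] at h2

/-- `d/dσ u(γ σ) = v⁰ − T′(r) dr(v⃗)` for `u = t* − T(r)` along a future causal curve of the Kerr chart
(chain rule, `Kerr.hasFDerivAt_radius`, `hasDerivAt_bentHeight`). [folklore] -/
theorem hasDerivAt_u_causal (ha : |a| < M) (hγ : (Kerr.smoothMetric M a r₁).IsFutureCausalCurveOn
      ((Kerr.timeOrientation M a r₁ hM).ofLE le_top) γ s) {t : ℝ} (ht : t ∈ s) :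
    HasDerivAt (fun σ ↦ (γ σ : E4) 0 - bentHeight M a (Kerr.radius a (γ σ)))
      (deriv (fun σ ↦ (γ σ : E4)) t 0 - bentSlope M a (Kerr.radius a (γ t)) *
        Kerr.radiusGrad a (E4.spatial (γ t : E4)) (E4.spatial (deriv (fun σ ↦ (γ σ : E4)) t))) t := by
  have h1 := (causalCurve_velocity hγ ht).1
  have hx : 0 < Kerr.radius a (γ t) := Kerr.radius_pos_of_mem_region (γ t).2
  have htime : HasDerivAt (fun σ ↦ (γ σ : E4) 0) (deriv (fun σ ↦ (γ σ : E4)) t 0) t := by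
    have := (EuclideanSpace.proj (0 : Fin 4) : E4 →L[ℝ] ℝ).hasFDerivAt.comp_hasDerivAt t h1
    simpa [Function.comp_def] using this
  have hrad : HasDerivAt (fun σ ↦ Kerr.radius a (γ σ))
      (Kerr.radiusGrad a (E4.spatial (γ t : E4)) (E4.spatial (deriv (fun σ ↦ (γ σ : E4)) t))) t := by
    have := (Kerr.hasFDerivAt_radius hx).comp_hasDerivAt t h1
    simpa [Function.comp_def] using this
  exact htime.sub ((hasDerivAt_bentHeight ha _).comp t hrad)

/-- **`u = t* − T(r)` is strictly increasing along future CAUSAL curves** of the Kerr chart on an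
interval (`CollarCauchy.clock_pos` with the slope `T′ ≥ 0` — the covector `dt* − T′dr` is timelike,
`CollarCauchy.numerator_bentSlope_neg`, and co-oriented — and the mean value theorem).
Dafermos–Rodnianski arXiv:0811.0354, §5.1. [cite: arXiv08110354, §5.1] -/
theorem strictMonoOn_u (ha : |a| < M) (hs : s.OrdConnected)
    (hγ : (Kerr.smoothMetric M a r₁).IsFutureCausalCurveOn
      ((Kerr.timeOrientation M a r₁ hM).ofLE le_top) γ s) :
    StrictMonoOn (fun σ ↦ (γ σ : E4) 0 - bentHeight M a (Kerr.radius a (γ σ))) s := by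
  refine strictMonoOn_of_deriv_pos hs.convex
    (fun t ht ↦ (hasDerivAt_u_causal ha hγ ht).continuousAt.continuousWithinAt) fun t ht ↦ ?_
  have ht' := interior_subset ht
  rw [(hasDerivAt_u_causal ha hγ ht').deriv]
  obtain ⟨-, hc, hne, hfd⟩ := causalCurve_velocity hγ ht'
  have hx : 0 < Kerr.radius a (γ t) := Kerr.radius_pos_of_mem_region (γ t).2
  have hH := Kerr.scalarH_nonneg hM a (γ t : E4)
  have hκ := bentSlope_nonneg ha (Kerr.radius a (γ t))
  exact CollarCauchy.clock_pos hM hx (CollarCauchy.numerator_bentSlope_neg ha hx) (by positivity) hc hne hfd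

/-- **Future causal curves issuing from `{u ≥ 0}` stay in `{u ≥ 0}`**, hence in the tapered collar
`W = {0 < u + (r − r₁)/4}` (`r > r₁` on the chart). In particular every future causal curve on `[b₁, b₂]`
which starts on the bent leaf `{x⁰ = T(r)}` lies in `W`. Dafermos–Rodnianski arXiv:0811.0354, §5.1.
[cite: arXiv08110354, §5.1] -/
theorem curve_mem_collar (ha : |a| < M) (hs : s.OrdConnected)
    (hγ : (Kerr.smoothMetric M a r₁).IsFutureCausalCurveOn
      ((Kerr.timeOrientation M a r₁ hM).ofLE le_top) γ s)
    {t₀ : ℝ} (h₀ : t₀ ∈ s) (hu₀ : bentHeight M a (Kerr.radius a (γ t₀)) ≤ (γ t₀ : E4) 0)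
    {t : ℝ} (ht : t ∈ s) (h₀t : t₀ ≤ t) :
    0 < (γ t : E4) 0 - bentHeight M a (Kerr.radius a (γ t : E4)) + (Kerr.radius a (γ t : E4) - r₁) / 4 := by
  have hmono := (strictMonoOn_u ha hs hγ).monotoneOn h₀ ht h₀t
  simp only at hmono
  have hr : r₁ < Kerr.radius a (γ t : E4) := (le_max_left _ _).trans_lt (Kerr.mem_region.1 (γ t).2)
  linarith

end Clock

/-! ## Pushing `J⁺` through a map which is good only on a set -/

section Push

variable {E : Type*} [NormedAddCommGroup E] [NormedSpace ℝ E] {H : Type*} [TopologicalSpace H]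
  {I : ModelWithCorners ℝ E H} {M : Type*} [TopologicalSpace M] [ChartedSpace H M] [IsManifold I ∞ M]
  {E' : Type*} [NormedAddCommGroup E'] [NormedSpace ℝ E'] {H' : Type*} [TopologicalSpace H']
  {I' : ModelWithCorners ℝ E' H'} {N : Type*} [TopologicalSpace N] [ChartedSpace H' N] [IsManifold I' ∞ N]
  {n : ℕ∞ω} {g : LorentzianMetric I n M} {τ : TimeOrientation g}
  {gN : LorentzianMetric I' n N} {τN : TimeOrientation gN}

/-- **`f(J⁺(S)) ⊆ J⁺(f(S))` for a map that is good only on a set `O`.** If `f : N → M` is differentiable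
at the points of `O` with a differential sending future-directed causal vectors to future-directed causal
vectors there, and every future causal curve of `N` on a compact parameter interval starting in `S` stays
in `O`, then `f` maps the causal future of `S` into the causal future of `f(S)` (push the connecting
causal curve through `f`: chain rule). O'Neill 1983, Ch. 14, pp. 402–403. [cite: ONeill1983, Ch. 14, pp. 402–403] -/
theorem image_causalFuture_subset {f : N → M} {O S : Set N}
    (hf : ∀ x ∈ O, MDifferentiableAt I' I f x ∧
      ∀ v : TangentSpace I' x, τN.IsFutureDirected v → τ.IsFutureDirected (mfderiv I' I f x v))
    (hO : ∀ (γ : ℝ → N) (b₁ b₂ : ℝ), b₁ < b₂ → gN.IsFutureCausalCurveOn τN γ (Icc b₁ b₂) → γ b₁ ∈ S →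
      ∀ t ∈ Icc b₁ b₂, γ t ∈ O) :
    f '' gN.causalFuture τN S ⊆ g.causalFuture τ (f '' S) := by
  rintro _ ⟨q, hq, rfl⟩
  rcases hq with hq | ⟨p, hp, γ, b₁, b₂, hb, hγ, hγa, hγb⟩
  · exact Or.inl (mem_image_of_mem f hq)
  · refine Or.inr ⟨f p, mem_image_of_mem f hp, f ∘ γ, b₁, b₂, hb, fun t ht ↦ ?_, ?_, ?_⟩
    · have hmem : γ t ∈ O := hO γ b₁ b₂ hb hγ (hγa ▸ hp) t ht
      obtain ⟨hd, hfd⟩ := hγ t ht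
      obtain ⟨hfd', hpres⟩ := hf (γ t) hmem
      refine ⟨hfd'.comp t hd, ?_⟩
      have hvel : velocity I (f ∘ γ) t = mfderiv I' I f (γ t) (velocity I' γ t) := by
        unfold velocity
        rw [mfderiv_comp t hfd' hd]
        rfl
      rw [hvel]
      exact hpres _ hfd
    · simp [hγa]
    · simp [hγb]

end Push

/-! ## The differential of the chart map at a point where it is isometric and oriented -/

section Differential

variable {M a r₁ : ℝ}
  {E' : Type*} [NormedAddCommGroup E'] [NormedSpace ℝ E'] {H' : Type*} [TopologicalSpace H']
  {I' : ModelWithCorners ℝ E' H'} {M' : Type*} [TopologicalSpace M'] [ChartedSpace H' M']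
  [IsManifold I' ∞ M'] {n : ℕ∞ω} {g : LorentzianMetric I' n M'} {τ : TimeOrientation g}
  {χ : Kerr.region a r₁ → M'} {x : Kerr.region a r₁}

/-- **At a point where `dχ` is isometric, `dχ` is injective** (nondegeneracy of `g_{M,a}`).
O'Neill 1983, Ch. 3, p. 58. [cite: ONeill1983, Ch. 3, p. 58] -/
theorem injective_mfderiv_of_iso
    (hiso : ∀ v w : E4, g.val (χ x) (mfderiv 𝓘(ℝ, E4) I' χ x v) (mfderiv 𝓘(ℝ, E4) I' χ x w) =
      Kerr.bilin M a (x : E4) v w) :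
    Injective (mfderiv 𝓘(ℝ, E4) I' χ x) := by
  refine (injective_iff_map_eq_zero _).2 fun v hv ↦ ?_
  refine Kerr.bilin_nondegenerate M a (Kerr.radius_pos_of_mem_region x.2) v fun w ↦ ?_
  rw [← hiso, hv, map_zero, _root_.zero_apply]

/-- **`dχ` carries the future causal cone of the Kerr chart INTO the future causal cone of the target**
at a point where it is isometric and sends `V = Kerr.timeVector` into the future: `dχ V` is future
timelike, `dχ v` is causal with `g(dχ V, dχ v) = g_{M,a}(V, v) < 0`, and the timecone lemma applies.
O'Neill 1983, Ch. 5, Lemma 5.29 and p. 145. [cite: ONeill1983, Ch. 5, p. 145] -/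
theorem isFutureDirected_mfderiv_of_iso [Kerr.Facts] (hM : 0 ≤ M)
    (hiso : ∀ v w : E4, g.val (χ x) (mfderiv 𝓘(ℝ, E4) I' χ x v) (mfderiv 𝓘(ℝ, E4) I' χ x w) =
      Kerr.bilin M a (x : E4) v w)
    (hor : g.val (χ x) (τ.vectorField (χ x)) (mfderiv 𝓘(ℝ, E4) I' χ x (Kerr.timeVector M a (x : E4))) < 0)
    {v : E4} (hv : (((Kerr.timeOrientation M a r₁ hM).ofLE le_top :
      TimeOrientation (Kerr.smoothMetric M a r₁))).IsFutureDirected (show TangentSpace 𝓘(ℝ, E4) x from v)) :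
    τ.IsFutureDirected (mfderiv 𝓘(ℝ, E4) I' χ x v) := by
  have hx : 0 < Kerr.radius a (x : E4) := Kerr.radius_pos_of_mem_region x.2
  obtain ⟨⟨hc, hne⟩, hVv⟩ := hv
  change Kerr.bilin M a x v v ≤ 0 at hc
  change Kerr.bilin M a x (Kerr.timeVector M a x) v < 0 at hVv
  have hVV : g.val (χ x) (mfderiv 𝓘(ℝ, E4) I' χ x (Kerr.timeVector M a (x : E4)))
      (mfderiv 𝓘(ℝ, E4) I' χ x (Kerr.timeVector M a (x : E4))) < 0 := by
    rw [hiso]; exact Kerr.bilin_timeVector_timeVector_neg hM a hx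
  have hT : τ.IsFutureDirected (mfderiv 𝓘(ℝ, E4) I' χ x (Kerr.timeVector M a (x : E4))) :=
    ⟨⟨hVV.le, fun h0 ↦ by simp [h0] at hVV⟩, hor⟩
  refine τ.isFutureDirected_of_val_lt_zero hT hVV ⟨?_, ?_⟩ ?_
  · change g.val (χ x) (mfderiv 𝓘(ℝ, E4) I' χ x v) (mfderiv 𝓘(ℝ, E4) I' χ x v) ≤ 0
    rw [hiso]; exact hc
  · intro h0
    exact hne ((injective_mfderiv_of_iso hiso) (h0.trans (map_zero _).symm))
  · rw [hiso]; exact hVv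

/-- **Conversely, a vector whose image under `dχ` is future-directed is future-directed in the chart**
(same point, same hypotheses): `v` is causal by the isometry and injectivity, and
`g_{M,a}(V, v) = g(dχ V, dχ v) < 0` because `dχ V` is future timelike. O'Neill 1983, Ch. 5, p. 145.
[cite: ONeill1983, Ch. 5, p. 145] -/
theorem isFutureDirected_of_mfderiv_of_iso [Kerr.Facts] (hM : 0 ≤ M)
    (hiso : ∀ v w : E4, g.val (χ x) (mfderiv 𝓘(ℝ, E4) I' χ x v) (mfderiv 𝓘(ℝ, E4) I' χ x w) =
      Kerr.bilin M a (x : E4) v w)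
    (hor : g.val (χ x) (τ.vectorField (χ x)) (mfderiv 𝓘(ℝ, E4) I' χ x (Kerr.timeVector M a (x : E4))) < 0)
    {v : E4} (hv : τ.IsFutureDirected (mfderiv 𝓘(ℝ, E4) I' χ x v)) :
    (((Kerr.timeOrientation M a r₁ hM).ofLE le_top :
      TimeOrientation (Kerr.smoothMetric M a r₁))).IsFutureDirected (show TangentSpace 𝓘(ℝ, E4) x from v) := by
  have hx : 0 < Kerr.radius a (x : E4) := Kerr.radius_pos_of_mem_region x.2
  have hVV : g.val (χ x) (mfderiv 𝓘(ℝ, E4) I' χ x (Kerr.timeVector M a (x : E4)))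
      (mfderiv 𝓘(ℝ, E4) I' χ x (Kerr.timeVector M a (x : E4))) < 0 := by
    rw [hiso]; exact Kerr.bilin_timeVector_timeVector_neg hM a hx
  have hT : τ.IsFutureDirected (mfderiv 𝓘(ℝ, E4) I' χ x (Kerr.timeVector M a (x : E4))) :=
    ⟨⟨hVV.le, fun h0 ↦ by simp [h0] at hVV⟩, hor⟩
  have key := TimeOrientation.IsFutureDirected.val_lt_zero τ hT hVV hv
  rw [hiso] at key
  obtain ⟨⟨hc, hne⟩, -⟩ := hv
  rw [hiso] at hc
  refine ⟨⟨hc, fun h0 ↦ hne ?_⟩, key⟩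
  change v = 0 at h0
  subst h0
  exact map_zero _

end Differential

end ScriTransport

open ScriTransport in
/-- **Registered sub-goal `stub_scriTransportClock` — the clock `u = t* − T(r)` runs forward along every
future causal curve of the ingoing Kerr–Schild chart.**  For sub-extremal `(M, a)`, `0 ≤ M`, and every future
causal curve `γ` of `(Kerr.region a r₁, g_{M,a}, −g♯dt*)` on an interval `s`, the function
`σ ↦ (γ σ)⁰ − T(r(γ σ))` (`T = bentHeight M a`) is strictly increasing on `s` (the conormal `dt* − T′dr` is
timelike and co-oriented with `V`; `ScriTransport.strictMonoOn_u`).  This is the engine that keeps causal curves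
issuing from the bent leaf inside the tapered collar `W`, both for the maximal null rays and for the connecting
curves of `J⁺`, in stub S5 `stub_scriTransport` (and S7). Dafermos–Rodnianski arXiv:0811.0354, §5.1.
[cite: arXiv08110354, §5.1] -/
theorem stub_scriTransportClock : ∀ [Kerr.Facts] (M a r₁ : ℝ) (hM : 0 ≤ M), |a| < M →
    ∀ (γ : ℝ → Kerr.region a r₁) (s : Set ℝ), s.OrdConnected →
      (Kerr.smoothMetric M a r₁).IsFutureCausalCurveOn ((Kerr.timeOrientation M a r₁ hM).ofLE le_top) γ s →
      StrictMonoOn (fun σ ↦ (γ σ : E4) 0 -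
        Summit.FinalStateConjecture.FinalStateConjecture.Theorems.KerrShieldedDataExist.Negative.bentHeight M a
          (Kerr.radius a (γ σ))) s :=
  fun _ _ _ _ ha γ _ hs hγ ↦ strictMonoOn_u (γ := γ) ha hs hγ


end Summit.FinalStateConjecture.FinalStateConjecture.Theorems.SwallowTheDatum.KerrShieldedSettles

end
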